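import Mathlib
import Summits.QuantumFields.YangMills.Theorems.ConvexGribovBodyContinuumLegGivenGapStubCsclIvCS
import Summits.QuantumFields.YangMills.Theorems.ConvexGribovBodyContinuumLegGivenGapStubCsclConv
import Summits.QuantumFields.YangMills.Theorems.ConvexGribovBodyContinuumLegGivenGapStubCsclLattice
import HarnessLib

/-!
# `ContinuumLegGivenGap` (stmt-QuantumFields-15828), line `Sketch`, reshape 18b: `stub_csclLimitCS` — the exact limit Cauchy–Schwarz inequality for near representatives

Support file for the crux item stmt-QuantumFields-15828 (registered glue stub `stub_csclLimitCS` of line `Sketch`, reshape 18b).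

For two weighted lattice representatives `𝔛_w(V) = ∑ₓ w(x) ∏ᵢ (P(θ_{xᵢ} V) − mc)` (`P = r.curvature.F`,
`θ_x = configShift (−x)`, `x` ranging over `n`- resp. `m`-tuples of `box 4 R`) whose weights are supported on tuples
with lattice times in `[1, T]`, along a strictly increasing sequence of tori `S_j ≥ S₁` on which every raw monomial
pairing `∫ (∏ᵢ P(θ_{uᵢ} Θ Ũ)) (∏ᵢ P(θ_{vᵢ} τ^σ Ũ)) dμ` converges (`Θ = cfgReflect`, `τ^σ = configShift (−σ e₀)`,
`Ũ = torusLift (2 S_j + 1) U`), and under the locked volume-uniform lattice gap at rate `μ`: the centred pairings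
`𝒫°_σ(𝔛_w, 𝔛_{w'}) = 𝒫_σ − conj(E 𝔛_w) E 𝔛_{w'}` converge, the real parts of the centred diagonal pairings
`𝒫°_0(𝔛_w, 𝔛_w)`, `𝒫°_0(𝔛_{w'}, 𝔛_{w'})` converge to `vX`, `vY`, and the limit `l_σ` of the cross pairing obeys the
exact clustering bound `‖l_σ‖ ≤ e^{−μσ} √vX √vY`.

Proof: (1) `limitCS_conv` — the pairings and means of the representatives converge, by the `G`-blind bookkeeping
`csclConv_pairing` / `csclConv_mean` of the landed `stub_csclConv` file (finite complex combinations of raw monomials;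
for the mean use the empty `Θ`-string and `σ = 0`, `configShift (−0·e₀) = id`); (2) `limitCS_package` — the
representative is measurable, bounded, a cylinder on the translated curvature supports of the time-window tuples
(edge times in `[1, T + 1]`, curvature support coordinates are `0` or `1`), with `Re`/`Im` of `𝔛` and `𝔛 ∘ Θ` local
gauge-invariant observables (`csclLattice_rep_*` of the landed `stub_csclLattice` file, `LocalGaugeObservable.timeReflect`);
(3) the landed asymptotic Cauchy–Schwarz clustering `stub_csclIvCS` gives, for every `ε > 0`, eventually
`‖𝒫°_σ‖ ≤ e^{−μσ} √Re 𝒫°_0(𝔛_w,𝔛_w) √Re 𝒫°_0(𝔛_{w'},𝔛_{w'}) + ε`; pass to the limit (`limitCS_limit`: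
`le_of_tendsto_of_tendsto`, then `ε ↓ 0`). No definitions, no facts; Mathlib + landed tree lemmas only. [folklore]
-/

noncomputable section

namespace Summit.QuantumFields.YangMills.Theorems.ContinuumLegGivenGap

open scoped SchwartzMap ComplexConjugate
open Filter Topology MeasureTheory
open Literature.MathematicalPhysics.QuantumFieldTheory Literature.MathematicalPhysics.QuantumLattice
  Literature.MathematicalPhysics.AQFT Literature.Probability.LatticeModels
open Summit.QuantumFields.YangMills.Cruxes.ContinuumLimitOnTrajectory.TwoOrbitSynchronisation (curvDistribution)

/-! ### (3) Passing to the limit in an asymptotic inequality -/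

/-- If `c_j → l`, `gX_j → vX`, `gY_j → vY` and for every `ε > 0` eventually `‖c_j‖ ≤ K √gX_j √gY_j + ε`, then
`‖l‖ ≤ K √vX √vY` (closedness of `≤` under limits, then `ε ↓ 0`). [folklore] -/
theorem limitCS_limit {c : ℕ → ℂ} {gX gY : ℕ → ℝ} {l : ℂ} {vX vY K : ℝ}
    (hc : Tendsto c atTop (𝓝 l)) (hX : Tendsto gX atTop (𝓝 vX)) (hY : Tendsto gY atTop (𝓝 vY))
    (h : ∀ ε : ℝ, 0 < ε → ∀ᶠ j in atTop, ‖c j‖ ≤ K * Real.sqrt (gX j) * Real.sqrt (gY j) + ε) :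
    ‖l‖ ≤ K * Real.sqrt vX * Real.sqrt vY :=
  le_of_forall_pos_le_add fun ε hε =>
    le_of_tendsto_of_tendsto hc.norm (((hX.sqrt.const_mul K).mul hY.sqrt).add_const ε) (h ε hε)

/-! ### (1) Convergence of the pairings and means of weighted representatives -/

/-- **Convergence of pairings and means of weighted representatives from the raw monomial data.** If along the odd
torus sides `2 Sq j + 1` every raw monomial pairing `∫ (∏ᵢ P(θ_{uᵢ} Θ Ũ)) (∏ᵢ P(θ_{vᵢ} τ^σ Ũ)) dμ` converges, then
for all finite weights `w, w'` the pairing `∫ conj 𝔛_w(Θ Ũ) · 𝔛_{w'}(τ^σ Ũ) dμ` and the mean `∫ 𝔛_w(Ũ) dμ` of the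
representatives `𝔛_w(V) = ∑ₓ w(x) ∏ᵢ (P(θ_{xᵢ} V) − mc)` converge (`csclConv_pairing`, `csclConv_mean`; the proof
is that of `stub_csclConv` with general weights). [folklore] -/
theorem limitCS_conv :
    ∀ (G : Type) [Group G] [TopologicalSpace G] [IsTopologicalGroup G] [CompactSpace G]
      [MeasurableSpace G] [BorelSpace G] (r : LatticeRep G) (β : ℝ) (Sq : ℕ → ℕ),
      (∀ (p q : ℕ) (u : Fin p → Site 4) (v : Fin q → Site 4) (σ : ℕ), ∃ l : ℝ,
        Tendsto (fun j : ℕ => ∫ U : GaugeConfig 4 (2 * Sq j + 1) G,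
          (∏ i : Fin p, r.curvature.F (configShift (-(u i)) (cfgReflect (torusLift (2 * Sq j + 1) U)))) *
            (∏ i : Fin q, r.curvature.F (configShift (-(v i)) (configShift (-(Pi.single 0 ((σ : ℕ) : ℤ))) (torusLift (2 * Sq j + 1) U))))
          ∂(wilsonMeasure r.ρ β)) atTop (𝓝 l)) →
      ∀ (n m R : ℕ) (mc : ℝ) (w : (Fin n → ↥(box 4 R)) → ℂ) (w' : (Fin m → ↥(box 4 R)) → ℂ) (σ : ℕ),
        (∃ l : ℂ, Tendsto (fun j : ℕ => ∫ U : GaugeConfig 4 (2 * Sq j + 1) G, (starRingEnd ℂ) ((fun V => ∑ x : Fin n → ↥(box 4 R), w x * ∏ i, ((r.curvature.F (configShift (-↑(x i)) V) - mc : ℝ) : ℂ)) (cfgReflect (torusLift (2 * Sq j + 1) U))) * (fun V => ∑ x : Fin m → ↥(box 4 R), w' x * ∏ i, ((r.curvature.F (configShift (-↑(x i)) V) - mc : ℝ) : ℂ)) (configShift (-(Pi.single 0 ((σ : ℕ) : ℤ))) (torusLift (2 * Sq j + 1) U)) ∂(wilsonMeasure r.ρ β)) atTop (𝓝 l)) 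∧
        (∃ l : ℂ, Tendsto (fun j : ℕ => ∫ U : GaugeConfig 4 (2 * Sq j + 1) G, (fun V => ∑ x : Fin n → ↥(box 4 R), w x * ∏ i, ((r.curvature.F (configShift (-↑(x i)) V) - mc : ℝ) : ℂ)) (torusLift (2 * Sq j + 1) U) ∂(wilsonMeasure r.ρ β)) atTop (𝓝 l)) := by
  intro G _ _ _ _ _ _ r β Sq H n m R mc w w' σ
  obtain ⟨C, hC⟩ := r.curvature.bounded
  have hC0 : 0 ≤ C := (abs_nonneg _).trans (hC fun _ => 1)
  have hμ : ∀ j : ℕ, IsFiniteMeasure (wilsonMeasure (d := 4) (L := 2 * Sq j + 1) r.ρ β) := fun j => by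
    haveI := isProbabilityMeasure_wilsonMeasure (d := 4) (L := 2 * Sq j + 1) r.ρ r.continuous β
    infer_instance
  -- measurability of the three kinds of shifted factors read on the lift
  have hmA : ∀ (s : Site 4) (j : ℕ), Measurable fun U : GaugeConfig 4 (2 * Sq j + 1) G =>
      r.curvature.F (Literature.MathematicalPhysics.QuantumLattice.configShift (-s) (cfgReflect (torusLift (2 * Sq j + 1) U))) := fun s j =>
    r.curvature.measurable.comp
      ((Literature.MathematicalPhysics.QuantumLattice.configShift _).measurable.comp (measurable_cfgReflect.comp (measurable_torusLift _)))
  have hmB : ∀ (s : Site 4) (j : ℕ), Measurable fun U : GaugeConfig 4 (2 * Sq j + 1) G =>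
      r.curvature.F (Literature.MathematicalPhysics.QuantumLattice.configShift (-s) (Literature.MathematicalPhysics.QuantumLattice.configShift (-(Pi.single 0 ((σ : ℕ) : ℤ))) (torusLift (2 * Sq j + 1) U))) :=
    fun s j => r.curvature.measurable.comp
      ((Literature.MathematicalPhysics.QuantumLattice.configShift _).measurable.comp ((Literature.MathematicalPhysics.QuantumLattice.configShift _).measurable.comp (measurable_torusLift _)))
  have hmB' : ∀ (s : Site 4) (j : ℕ), Measurable fun U : GaugeConfig 4 (2 * Sq j + 1) G =>
      r.curvature.F (Literature.MathematicalPhysics.QuantumLattice.configShift (-s) (torusLift (2 * Sq j + 1) U)) := fun s j =>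
    r.curvature.measurable.comp ((Literature.MathematicalPhysics.QuantumLattice.configShift _).measurable.comp (measurable_torusLift _))
  refine ⟨?_, ?_⟩
  · exact csclConv_pairing (Ω := fun j => GaugeConfig 4 (2 * Sq j + 1) G)
      (fun j => wilsonMeasure (d := 4) (L := 2 * Sq j + 1) r.ρ β) hμ
      (fun (s : Site 4) j U => r.curvature.F (Literature.MathematicalPhysics.QuantumLattice.configShift (-s) (cfgReflect (torusLift (2 * Sq j + 1) U))))
      (fun (s : Site 4) j U => r.curvature.F
        (Literature.MathematicalPhysics.QuantumLattice.configShift (-s) (Literature.MathematicalPhysics.QuantumLattice.configShift (-(Pi.single 0 ((σ : ℕ) : ℤ))) (torusLift (2 * Sq j + 1) U))))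
      hC0 hmA hmB (fun _ _ _ => hC _) (fun _ _ _ => hC _) (fun p q u v => H p q u v σ)
      w w' (fun (x : Fin n → ↥(box 4 R)) i => (↑(x i) : Site 4)) (fun (x : Fin m → ↥(box 4 R)) i => (↑(x i) : Site 4)) mc
  · -- the mean: empty `Θ`-string and `σ = 0` (`configShift (-(0 • e₀)) = id`)
    have h0 : ∀ W : LGConfig 4 G, Literature.MathematicalPhysics.QuantumLattice.configShift (-(Pi.single 0 ((0 : ℕ) : ℤ)) : Site 4) W = W := fun W => by
      funext e
      simp [Literature.MathematicalPhysics.QuantumLattice.configShift_apply]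
    have H0 : ∀ (p q : ℕ) (u : Fin p → Site 4) (v : Fin q → Site 4), ∃ l : ℝ,
        Tendsto (fun j : ℕ => ∫ U : GaugeConfig 4 (2 * Sq j + 1) G,
          (∏ i : Fin p, r.curvature.F (Literature.MathematicalPhysics.QuantumLattice.configShift (-(u i)) (cfgReflect (torusLift (2 * Sq j + 1) U)))) *
            (∏ i : Fin q, r.curvature.F (Literature.MathematicalPhysics.QuantumLattice.configShift (-(v i)) (torusLift (2 * Sq j + 1) U)))
          ∂(wilsonMeasure r.ρ β)) atTop (𝓝 l) := fun p q u v => by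
      simpa only [h0] using H p q u v 0
    exact csclConv_mean (Ω := fun j => GaugeConfig 4 (2 * Sq j + 1) G)
      (fun j => wilsonMeasure (d := 4) (L := 2 * Sq j + 1) r.ρ β) hμ
      (fun (s : Site 4) j U => r.curvature.F (Literature.MathematicalPhysics.QuantumLattice.configShift (-s) (cfgReflect (torusLift (2 * Sq j + 1) U))))
      (fun (s : Site 4) j U => r.curvature.F (Literature.MathematicalPhysics.QuantumLattice.configShift (-s) (torusLift (2 * Sq j + 1) U)))
      hC0 hmA hmB' (fun _ _ _ => hC _) (fun _ _ _ => hC _) H0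
      w (fun (x : Fin n → ↥(box 4 R)) i => (↑(x i) : Site 4)) mc

/-! ### (2) Packaging of a weighted representative with weights in a time window -/

/-- **Packaging of `𝔛_w`.** For weights supported on tuples with lattice times in `[1, T]`, the representative
`𝔛_w(V) = ∑ₓ w(x) ∏ᵢ (P(θ_{xᵢ} V) − mc)` is measurable, bounded, a cylinder on the union over the time-window tuples of
the translated curvature supports (an edge set with times in `[1, T + 1]`: curvature support coordinates are `0` or
`1`), and `Re`/`Im` of `𝔛_w ∘ Θ₀` and of `𝔛_w` are local gauge-invariant observables (`csclLattice_rep_species` and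
`LocalGaugeObservable.timeReflect`, `Θ₀ = cfgReflect`). [folklore] -/
theorem limitCS_package {G : Type} [Group G] [TopologicalSpace G] [IsTopologicalGroup G] [CompactSpace G]
    [MeasurableSpace G] [BorelSpace G] (r : LatticeRep G) (T : ℕ) {n R : ℕ}
    (w : (Fin n → ↥(box 4 R)) → ℂ) (mc : ℝ)
    (hw : ∀ x, w x ≠ 0 → ∀ i, 1 ≤ (↑(x i) : Site 4) 0 ∧ (↑(x i) : Site 4) 0 ≤ (T : ℤ)) :
    Measurable (fun V : LGConfig 4 G => ∑ x : Fin n → ↥(box 4 R), w x * ∏ i, ((r.curvature.F (configShift (-↑(x i)) V) - mc : ℝ) : ℂ)) ∧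
    (∃ C : ℝ, ∀ V, ‖(fun V : LGConfig 4 G => ∑ x : Fin n → ↥(box 4 R), w x * ∏ i, ((r.curvature.F (configShift (-↑(x i)) V) - mc : ℝ) : ℂ)) V‖ ≤ C) ∧
    ∃ Λ : Finset (Literature.MathematicalPhysics.QuantumLattice.ZdEdge 4),
      IsCylinder (fun V : LGConfig 4 G => ∑ x : Fin n → ↥(box 4 R), w x * ∏ i, ((r.curvature.F (configShift (-↑(x i)) V) - mc : ℝ) : ℂ)) Λ ∧
      (∀ e ∈ Λ, 1 ≤ e.1 0 ∧ e.1 0 ≤ ((T + 1 : ℕ) : ℤ)) ∧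
      ∃ A₁ A₂ A₃ A₄ : YMSpecies G,
        (∀ V, A₁.F V = ((fun V : LGConfig 4 G => ∑ x : Fin n → ↥(box 4 R), w x * ∏ i, ((r.curvature.F (configShift (-↑(x i)) V) - mc : ℝ) : ℂ)) (cfgReflect V)).re) ∧
        (∀ V, A₂.F V = ((fun V : LGConfig 4 G => ∑ x : Fin n → ↥(box 4 R), w x * ∏ i, ((r.curvature.F (configShift (-↑(x i)) V) - mc : ℝ) : ℂ)) (cfgReflect V)).im) ∧
        (∀ V, A₃.F V = ((fun V : LGConfig 4 G => ∑ x : Fin n → ↥(box 4 R), w x * ∏ i, ((r.curvature.F (configShift (-↑(x i)) V) - mc : ℝ) : ℂ)) V).re) ∧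
        (∀ V, A₄.F V = ((fun V : LGConfig 4 G => ∑ x : Fin n → ↥(box 4 R), w x * ∏ i, ((r.curvature.F (configShift (-↑(x i)) V) - mc : ℝ) : ℂ)) V).im) := by
  -- the window edge set: translated curvature supports of the tuples with all times in `[1, T]`
  have hΛ : ∀ x, w x ≠ 0 → ∀ i, ∀ e ∈ r.curvature.supp, (e.1 + (↑(x i) : Site 4), e.2) ∈
      (Finset.univ.filter fun x : Fin n → ↥(box 4 R) =>
          ∀ i, 1 ≤ (↑(x i) : Site 4) 0 ∧ (↑(x i) : Site 4) 0 ≤ (T : ℤ)).biUnion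
        fun x => Finset.univ.biUnion fun i : Fin n =>
          r.curvature.supp.image fun e => (e.1 + (↑(x i) : Site 4), e.2) := by
    intro x hx i e he
    refine Finset.mem_biUnion.2 ⟨x, Finset.mem_filter.2 ⟨Finset.mem_univ _, hw x hx⟩, ?_⟩
    exact Finset.mem_biUnion.2 ⟨i, Finset.mem_univ _, Finset.mem_image.2 ⟨e, he, rfl⟩⟩
  obtain ⟨A₃, A₄, h3, h4⟩ := csclLattice_rep_species r.curvature w mc hΛ
  refine ⟨csclLattice_rep_measurable r.curvature w mc, csclLattice_rep_bounded r.curvature w mc, _,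
    csclLattice_rep_isCylinder r.curvature w mc hΛ, ?_, A₃.timeReflect, A₄.timeReflect, A₃, A₄,
    fun V => h3 (cfgReflect V), fun V => h4 (cfgReflect V), h3, h4⟩
  -- edges of the window edge set have times in `[1, T + 1]`
  intro e he
  obtain ⟨x, hx, he1⟩ := Finset.mem_biUnion.1 he
  obtain ⟨i, -, he2⟩ := Finset.mem_biUnion.1 he1
  obtain ⟨e', he', rfl⟩ := Finset.mem_image.1 he2
  have hxi := (Finset.mem_filter.1 hx).2 i
  have h01 := fst_mem_Icc_of_mem_curvature_supp r he' 0
  show 1 ≤ e'.1 0 + (↑(x i) : Site 4) 0 ∧ e'.1 0 + (↑(x i) : Site 4) 0 ≤ ((T + 1 : ℕ) : ℤ)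
  push_cast
  omega

/-! ### The registered stub -/

/-- `stub_csclLimitCS` — **the exact limit Cauchy–Schwarz clustering inequality for weighted near representatives**
(registered signature, reshape 18b; see the module docstring): under the lock at rate `μ`, for weights `w, w'`
supported at lattice times `1 … T` and convergent raw monomial pairings along the tori `S_j`, the real parts of the
centred diagonal pairings converge to `vX, vY`, every centred cross pairing `𝒫°_σ(𝔛_w, 𝔛_{w'})` converges, and its
limit `l_σ` satisfies `‖l_σ‖ ≤ e^{−μσ} √vX √vY`. Assembly of `limitCS_conv`, `limitCS_package`, the landed
`stub_csclIvCS`, and `limitCS_limit`. [folklore] -/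
theorem stub_csclLimitCS :
    ∀ (G : Type) [Group G] [TopologicalSpace G] [IsTopologicalGroup G] [CompactSpace G]
      [MeasurableSpace G] [BorelSpace G] (r : LatticeRep G) (β μ mc : ℝ) (S₁ T n m R : ℕ) (Sq : ℕ → ℕ)
      (w : (Fin n → ↥(box 4 R)) → ℂ) (w' : (Fin m → ↥(box 4 R)) → ℂ),
      0 ≤ β → 0 < μ → StrictMono Sq → (∀ j, S₁ ≤ Sq j) →
      (∀ A B : YMSpecies G, ∃ C : ℝ, ∀ S n : ℕ, S₁ ≤ S → n ≤ S →
        |latticeConnectedCorr r.ρ β (2 * S + 1) A.F B.F n| ≤ C * Real.exp (-(μ * n))) →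
      (∀ x, w x ≠ 0 → ∀ i, 1 ≤ (↑(x i) : Site 4) 0 ∧ (↑(x i) : Site 4) 0 ≤ (T : ℤ)) →
      (∀ y, w' y ≠ 0 → ∀ i, 1 ≤ (↑(y i) : Site 4) 0 ∧ (↑(y i) : Site 4) 0 ≤ (T : ℤ)) →
      (∀ (p q : ℕ) (u : Fin p → Site 4) (v : Fin q → Site 4) (σ : ℕ), ∃ l : ℝ,
        Tendsto (fun j : ℕ => ∫ U : GaugeConfig 4 (2 * Sq j + 1) G,
          (∏ i : Fin p, r.curvature.F (configShift (-(u i)) (cfgReflect (torusLift (2 * Sq j + 1) U)))) *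
            (∏ i : Fin q, r.curvature.F (configShift (-(v i)) (configShift (-(Pi.single 0 ((σ : ℕ) : ℤ))) (torusLift (2 * Sq j + 1) U))))
          ∂(wilsonMeasure r.ρ β)) atTop (𝓝 l)) →
      ∃ vX vY : ℝ,
        Tendsto (fun j : ℕ => (((∫ U : GaugeConfig 4 (2 * Sq j + 1) G, (starRingEnd ℂ) ((fun V => ∑ x : Fin n → ↥(box 4 R), w x * ∏ i, ((r.curvature.F (configShift (-↑(x i)) V) - mc : ℝ) : ℂ)) (cfgReflect (torusLift (2 * Sq j + 1) U))) * (fun V => ∑ x : Fin n → ↥(box 4 R), w x * ∏ i, ((r.curvature.F (configShift (-↑(x i)) V) - mc : ℝ) : ℂ)) (configShift (-(Pi.single 0 ((0 : ℕ) : ℤ))) (torusLift (2 * Sq j + 1) U)) ∂(wilsonMeasure r.ρ β)) - (starRingEnd ℂ) (∫ U : GaugeConfig 4 (2 * Sq j + 1) G, (fun V => ∑ x : Fin n → ↥(box 4 R), w x * ∏ i, ((r.curvature.F (configShift (-↑(x i)) V) - mc : ℝ) : ℂ)) (torusLift (2 * Sq j + 1) U) ∂(wilsonMeasure r.ρ β))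 * (∫ U : GaugeConfig 4 (2 * Sq j + 1) G, (fun V => ∑ x : Fin n → ↥(box 4 R), w x * ∏ i, ((r.curvature.F (configShift (-↑(x i)) V) - mc : ℝ) : ℂ)) (torusLift (2 * Sq j + 1) U) ∂(wilsonMeasure r.ρ β)))).re) atTop (𝓝 vX) ∧
        Tendsto (fun j : ℕ => (((∫ U : GaugeConfig 4 (2 * Sq j + 1) G, (starRingEnd ℂ) ((fun V => ∑ x : Fin m → ↥(box 4 R), w' x * ∏ i, ((r.curvature.F (configShift (-↑(x i)) V) - mc : ℝ) : ℂ)) (cfgReflect (torusLift (2 * Sq j + 1) U))) * (fun V => ∑ x : Fin m → ↥(box 4 R), w' x * ∏ i, ((r.curvature.F (configShift (-↑(x i)) V) - mc : ℝ) : ℂ)) (configShift (-(Pi.single 0 ((0 : ℕ) : ℤ))) (torusLift (2 * Sq j + 1) U)) ∂(wilsonMeasure r.ρ β)) - (starRingEnd ℂ) (∫ U : GaugeConfig 4 (2 * Sq j + 1) G, (fun V => ∑ x : Fin m → ↥(box 4 R), w' x * ∏ i, ((r.curvature.F (configShift (-↑(x i)) V) - mc : ℝ) : ℂ)) (torusLift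 (2 * Sq j + 1) U) ∂(wilsonMeasure r.ρ β)) * (∫ U : GaugeConfig 4 (2 * Sq j + 1) G, (fun V => ∑ x : Fin m → ↥(box 4 R), w' x * ∏ i, ((r.curvature.F (configShift (-↑(x i)) V) - mc : ℝ) : ℂ)) (torusLift (2 * Sq j + 1) U) ∂(wilsonMeasure r.ρ β)))).re) atTop (𝓝 vY) ∧
        ∀ σ : ℕ, ∃ l : ℂ, Tendsto (fun j : ℕ => ((∫ U : GaugeConfig 4 (2 * Sq j + 1) G, (starRingEnd ℂ) ((fun V => ∑ x : Fin n → ↥(box 4 R), w x * ∏ i, ((r.curvature.F (configShift (-↑(x i)) V) - mc : ℝ) : ℂ)) (cfgReflect (torusLift (2 * Sq j + 1) U))) * (fun V => ∑ x : Fin m → ↥(box 4 R), w' x * ∏ i, ((r.curvature.F (configShift (-↑(x i)) V) - mc : ℝ) : ℂ)) (configShift (-(Pi.single 0 ((σ : ℕ) : ℤ))) (torusLift (2 * Sq j + 1) U)) ∂(wilsonMeasure r.ρ β)) - (starRingEnd ℂ) (∫ U : GaugeConfig 4 (2 * Sq j + 1) G, (fun V => ∑ x : Fin n → ↥(box 4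 R), w x * ∏ i, ((r.curvature.F (configShift (-↑(x i)) V) - mc : ℝ) : ℂ)) (torusLift (2 * Sq j + 1) U) ∂(wilsonMeasure r.ρ β)) * (∫ U : GaugeConfig 4 (2 * Sq j + 1) G, (fun V => ∑ x : Fin m → ↥(box 4 R), w' x * ∏ i, ((r.curvature.F (configShift (-↑(x i)) V) - mc : ℝ) : ℂ)) (torusLift (2 * Sq j + 1) U) ∂(wilsonMeasure r.ρ β)))) atTop (𝓝 l) ∧
          ‖l‖ ≤ Real.exp (-(μ * σ)) * Real.sqrt vX * Real.sqrt vY := by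
  intro G _ _ _ _ _ _ r β μ mc S₁ T n m R Sq w w' hβ hμ hSq hS₁ hlock hw hw' H
  -- (2) packaging of the two representatives
  obtain ⟨hXm, hXb, ΛX, hXc, hΛX, hXs⟩ := limitCS_package r T w mc hw
  obtain ⟨hYm, hYb, ΛY, hYc, hΛY, -⟩ := limitCS_package r T w' mc hw'
  -- (3) the asymptotic Cauchy–Schwarz clustering inequality, fed by (1) and (2)
  have hiv := stub_csclIvCS G r β μ S₁ (T + 1) Sq _ _ ΛX ΛY hβ hμ hSq hS₁ hXm hYm hXb hYb hXc hYc hΛX hΛY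
    hlock hXs
    (fun σ => ⟨(limitCS_conv G r β Sq H n n R mc w w σ).1, (limitCS_conv G r β Sq H m m R mc w' w' σ).1,
      (limitCS_conv G r β Sq H n m R mc w w' σ).1⟩)
    (limitCS_conv G r β Sq H n m R mc w w' 0).2 (limitCS_conv G r β Sq H m n R mc w' w 0).2
  -- (1) the limits of the pairings and means
  obtain ⟨lXX, hlXX⟩ := (limitCS_conv G r β Sq H n n R mc w w 0).1
  obtain ⟨lYY, hlYY⟩ := (limitCS_conv G r β Sq H m m R mc w' w' 0).1
  obtain ⟨eX, heX⟩ := (limitCS_conv G r β Sq H n m R mc w w' 0).2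
  obtain ⟨eY, heY⟩ := (limitCS_conv G r β Sq H m n R mc w' w 0).2
  have hcX := (Complex.continuous_conj.tendsto _).comp heX
  have hcY := (Complex.continuous_conj.tendsto _).comp heY
  have hvX := (Complex.continuous_re.tendsto _).comp (hlXX.sub (hcX.mul heX))
  have hvY := (Complex.continuous_re.tendsto _).comp (hlYY.sub (hcY.mul heY))
  refine ⟨_, _, hvX, hvY, fun σ => ?_⟩
  obtain ⟨lXY, hlXY⟩ := (limitCS_conv G r β Sq H n m R mc w w' σ).1
  have hl := hlXY.sub (hcX.mul heY)
  exact ⟨_, hl, limitCS_limit hl hvX hvY (hiv σ)⟩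

end Summit.QuantumFields.YangMills.Theorems.ContinuumLegGivenGap

end
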